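import Summits.CriticalPhenomena.PercolationContinuityZ3.Theorems.PercNearOneGluingNoHeavyLowerTailSahiTwoLevelIdleFace

/-!
# The two-level TOP form with AT MOST ONE COSTLY SLOT: `T⁺ = E_3(G) + E_3(H_0,G_1,G_2) + (manifestly ≥ 0)`

Support file of the one-cut programme (crux `NoHeavyLowerTail`, stmt-CriticalPhenomena-4575; cell `prim-bnk`, seat bnk-2 gen 10, companion of
`…SahiTwoLevelIdleFace`; memo `run/shared/lean/prim/prim-l12/FROM-prim-bnk-2-g10-IDLE-FACE.md`).

For a nested pair `H_i ⊆ G_i` of triples of increasing events, a point removed from slot `a` (`x ∈ D_a = G_a ∖ H_a`) is COSTLY iff it lies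
in both other TOP events (`x ∈ G_b ∩ G_c`); slot `a` is COSTLESS iff `G_0 ∩ G_1 ∩ G_2 ⊆ H_a` (prim-ineq-gen-4's removal calculus (R): only
costly removals decrease the COMB-M⁺ slack).  THEOREM (`twoLevelTop_eq_of_costless₁₂`): if slots `1` and `2` are costless then
`T⁺ = E_3(G_0,G_1,G_2) + E_3(H_0,G_1,G_2) + δ_1·Cov(G_0,G_2) + δ_2·Cov(G_0,G_1) + μ(G_2)·μ(D_1 ∩ H_0) + μ(G_1)·μ(D_2 ∩ H_0) + μ(G_0)·μ(G_1G_2 ∖ H_1H_2)`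
(ring identity in the moments after the one set rewrite `H_0H_1H_2 = H_0G_1G_2`); every remainder term is manifestly `≥ 0` (Harris,
monotonicity), so `T⁺ ≥ E_3(G) + E_3(H_0,G_1,G_2)` (`sahiE3_add_sahiE3_le_twoLevelTop_of_costless₁₂`) and `SahiTwoLevelPlus` holds there given
`C_3` for two triples (`twoLevelTop_nonneg_of_costless₁₂`, `…_of_kahn`).  With exactly ONE costless slot (`twoLevelTop_eq_of_costless₀`):
`T⁺ = E_3(G_0,H_1,G_2) + E_3(G_0,G_1,H_2) + δ_0·Cov(G_1,G_2) + μ(G_2)μ(D_0∩H_1) + μ(G_1)μ(D_0∩H_2) + 2μ(G_0∩D_1∩D_2) − μ(G_0)μ(D_1∩D_2)`, whose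
ONLY negative term is `μ(G_0)·μ(D_1 ∩ D_2 ∖ G_0)`; hence `T⁺ ≥ E_3 + E_3` when `D_1 ∩ D_2 ⊆ G_0`
(`sahiE3_add_sahiE3_le_twoLevelTop_of_costless₀_inside`).  This contains all faces of `…SahiTwoLevelIdleFace` (one moving
slot; outside-`G_0` removals; the idle-slot sub-faces with one costless moving slot).  Consequently the measure-level two-level law `T⁺ ≥ 0`
is reduced to Kahn's conjecture EXCEPT when at least TWO slots have costly removals (two bottoms `H_a, H_b` each missing part of
`G_0 ∩ G_1 ∩ G_2`) AND — if the third slot `c` is costless — their common removed mass meets the complement of `G_c`; with all three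
slots costly nothing here applies.  The identity is formal in the degree-3 products of set masses, hence lifts to the three-copy comb array (memo §2):
`c_2 − c_3 = c(G) + c(H_0,G_1,G_2) + [fibre-Kleitman brackets]`, i.e. `c_2 ≥ 2c_3 + c(H_0,G_1,G_2)` coefficientwise on this face (census
m ≤ 4 exhaustive, m = 5 sampled: 0 violations).  HONEST LABEL: a face of `SahiTwoLevelPlus` conditional on `C_3`; nothing here asserts
`SahiTwoLevelPlus` or `C_3`. [this work]
-/

noncomputable section

open scoped Classical

namespace Summit.CriticalPhenomena.PercolationContinuityZ3.Theorems.SahiTwoLevelIdle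

open Finset Function MeasureTheory
open Literature.Combinatorics.Sahi2008
open Literature.Probability.LatticeModels (prodBernoulli prodBernoulli_harris sahiE3 sahiE3_def)
open Literature.Probability.Percolation.DecisionTree (ind ind_of_mem ind_of_not_mem ind_nonneg)

variable {κ : Type}

/-- **Costless slots `1, 2`, exact form**: if `H_i ⊆ G_i` (`i = 0,1,2`) and `G_0 ∩ G_1 ∩ G_2 ⊆ H_1`, `G_0 ∩ G_1 ∩ G_2 ⊆ H_2` then
`T⁺ = E_3(G_0,G_1,G_2) + E_3(H_0,G_1,G_2) + δ_1 Cov(G_0,G_2) + δ_2 Cov(G_0,G_1) + μ(G_2)(μ(H_0G_1) − μ(H_0H_1)) + μ(G_1)(μ(H_0G_2) − μ(H_0H_2))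
 + μ(G_0)(μ(G_1G_2) − μ(H_1H_2))`. [this work] -/
theorem twoLevelTop_eq_of_costless₁₂ (q : κ → unitInterval) (G H : Fin 3 → Set (Set κ)) (hH0 : H 0 ⊆ G 0)
    (hH1 : H 1 ⊆ G 1) (hH2 : H 2 ⊆ G 2) (hc1 : G 0 ∩ G 1 ∩ G 2 ⊆ H 1) (hc2 : G 0 ∩ G 1 ∩ G 2 ⊆ H 2) :
    twoLevelForm (fun A => (prodBernoulli q).real A) G H
        - ∏ i, ((prodBernoulli q).real (G i) - (prodBernoulli q).real (H i)) =
      sahiE3 (prodBernoulli q) (G 0) (G 1) (G 2) + sahiE3 (prodBernoulli q) (H 0) (G 1) (G 2)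
      + ((prodBernoulli q).real (G 1) - (prodBernoulli q).real (H 1))
          * ((prodBernoulli q).real (G 0 ∩ G 2) - (prodBernoulli q).real (G 0) * (prodBernoulli q).real (G 2))
      + ((prodBernoulli q).real (G 2) - (prodBernoulli q).real (H 2))
          * ((prodBernoulli q).real (G 0 ∩ G 1) - (prodBernoulli q).real (G 0) * (prodBernoulli q).real (G 1))
      + (prodBernoulli q).real (G 2) * ((prodBernoulli q).real (H 0 ∩ G 1) - (prodBernoulli q).real (H 0 ∩ H 1))
      + (prodBernoulli q).real (G 1) * ((prodBernoulli q).real (H 0 ∩ G 2) - (prodBernoulli q).real (H 0 ∩ H 2))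
      + (prodBernoulli q).real (G 0) * ((prodBernoulli q).real (G 1 ∩ G 2) - (prodBernoulli q).real (H 1 ∩ H 2)) := by
  have e3 : H 0 ∩ H 1 ∩ H 2 = H 0 ∩ G 1 ∩ G 2 := by
    ext ω; simp only [Set.mem_inter_iff]
    exact ⟨fun ⟨⟨a, b⟩, c⟩ => ⟨⟨a, hH1 b⟩, hH2 c⟩,
      fun ⟨⟨a, b⟩, c⟩ => ⟨⟨a, hc1 ⟨⟨hH0 a, b⟩, c⟩⟩, hc2 ⟨⟨hH0 a, b⟩, c⟩⟩⟩
  simp only [twoLevelForm, Fin.prod_univ_three, sahiE3_def]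
  rw [e3]
  ring

/-- **`T⁺ ≥ E_3(G_0,G_1,G_2) + E_3(H_0,G_1,G_2)` when slots `1, 2` are costless** (Harris for `(G_0,G_i)`, monotonicity). [this work] -/
theorem sahiE3_add_sahiE3_le_twoLevelTop_of_costless₁₂ [Fintype κ] (q : κ → unitInterval) (G H : Fin 3 → Set (Set κ))
    (hG : ∀ i, IsUpperSet (G i)) (hH0 : H 0 ⊆ G 0) (hH1 : H 1 ⊆ G 1) (hH2 : H 2 ⊆ G 2)
    (hc1 : G 0 ∩ G 1 ∩ G 2 ⊆ H 1) (hc2 : G 0 ∩ G 1 ∩ G 2 ⊆ H 2) :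
    sahiE3 (prodBernoulli q) (G 0) (G 1) (G 2) + sahiE3 (prodBernoulli q) (H 0) (G 1) (G 2) ≤
      twoLevelForm (fun A => (prodBernoulli q).real A) G H
        - ∏ i, ((prodBernoulli q).real (G i) - (prodBernoulli q).real (H i)) := by
  rw [twoLevelTop_eq_of_costless₁₂ q G H hH0 hH1 hH2 hc1 hc2]
  have hδ1 : 0 ≤ (prodBernoulli q).real (G 1) - (prodBernoulli q).real (H 1) := sub_nonneg.2 (measureReal_mono hH1)
  have hδ2 : 0 ≤ (prodBernoulli q).real (G 2) - (prodBernoulli q).real (H 2) := sub_nonneg.2 (measureReal_mono hH2)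
  have hcv1 : 0 ≤ (prodBernoulli q).real (G 0 ∩ G 1) - (prodBernoulli q).real (G 0) * (prodBernoulli q).real (G 1) :=
    sub_nonneg.2 (prodBernoulli_harris q (hG 0) (hG 1) MeasurableSet.of_discrete MeasurableSet.of_discrete)
  have hcv2 : 0 ≤ (prodBernoulli q).real (G 0 ∩ G 2) - (prodBernoulli q).real (G 0) * (prodBernoulli q).real (G 2) :=
    sub_nonneg.2 (prodBernoulli_harris q (hG 0) (hG 2) MeasurableSet.of_discrete MeasurableSet.of_discrete)
  have hm1 : 0 ≤ (prodBernoulli q).real (H 0 ∩ G 1) - (prodBernoulli q).real (H 0 ∩ H 1) :=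
    sub_nonneg.2 (measureReal_mono (Set.inter_subset_inter_right _ hH1))
  have hm2 : 0 ≤ (prodBernoulli q).real (H 0 ∩ G 2) - (prodBernoulli q).real (H 0 ∩ H 2) :=
    sub_nonneg.2 (measureReal_mono (Set.inter_subset_inter_right _ hH2))
  have hm : 0 ≤ (prodBernoulli q).real (G 1 ∩ G 2) - (prodBernoulli q).real (H 1 ∩ H 2) :=
    sub_nonneg.2 (measureReal_mono (Set.inter_subset_inter hH1 hH2))
  have hg0 : 0 ≤ (prodBernoulli q).real (G 0) := measureReal_nonneg
  have hg1 : 0 ≤ (prodBernoulli q).real (G 1) := measureReal_nonneg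
  have hg2 : 0 ≤ (prodBernoulli q).real (G 2) := measureReal_nonneg
  nlinarith [mul_nonneg hδ1 hcv2, mul_nonneg hδ2 hcv1, mul_nonneg hg2 hm1, mul_nonneg hg1 hm2, mul_nonneg hg0 hm]

/-- **`SahiTwoLevelPlus` with at most one costly slot, from `C_3`** for `(G_0,G_1,G_2)` and `(H_0,G_1,G_2)`. [this work] -/
theorem twoLevelTop_nonneg_of_costless₁₂ [Fintype κ] (q : κ → unitInterval) (G H : Fin 3 → Set (Set κ))
    (hG : ∀ i, IsUpperSet (G i)) (hH0 : H 0 ⊆ G 0) (hH1 : H 1 ⊆ G 1) (hH2 : H 2 ⊆ G 2)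
    (hc1 : G 0 ∩ G 1 ∩ G 2 ⊆ H 1) (hc2 : G 0 ∩ G 1 ∩ G 2 ⊆ H 2)
    (hE₃G : 0 ≤ sahiE3 (prodBernoulli q) (G 0) (G 1) (G 2)) (hE₃H : 0 ≤ sahiE3 (prodBernoulli q) (H 0) (G 1) (G 2)) :
    0 ≤ twoLevelForm (fun A => (prodBernoulli q).real A) G H
        - ∏ i, ((prodBernoulli q).real (G i) - (prodBernoulli q).real (H i)) :=
  le_trans (add_nonneg hE₃G hE₃H) (sahiE3_add_sahiE3_le_twoLevelTop_of_costless₁₂ q G H hG hH0 hH1 hH2 hc1 hc2)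

/-- The same from Kahn's Conjecture 5 (`H_0` increasing as well). [this work] -/
theorem twoLevelTop_nonneg_of_costless₁₂_of_kahn [Fintype κ] (hK : KahnConjecture) (q : κ → unitInterval)
    (G H : Fin 3 → Set (Set κ)) (hG : ∀ i, IsUpperSet (G i)) (hH0u : IsUpperSet (H 0)) (hH0 : H 0 ⊆ G 0)
    (hH1 : H 1 ⊆ G 1) (hH2 : H 2 ⊆ G 2) (hc1 : G 0 ∩ G 1 ∩ G 2 ⊆ H 1) (hc2 : G 0 ∩ G 1 ∩ G 2 ⊆ H 2) :
    0 ≤ twoLevelForm (fun A => (prodBernoulli q).real A) G H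
        - ∏ i, ((prodBernoulli q).real (G i) - (prodBernoulli q).real (H i)) :=
  twoLevelTop_nonneg_of_costless₁₂ q G H hG hH0 hH1 hH2 hc1 hc2 (hK κ q _ _ _ (hG 0) (hG 1) (hG 2))
    (hK κ q _ _ _ hH0u (hG 1) (hG 2))


/-! ### Exactly one costless slot: the single deficit term -/

/-- **Slot `0` costless, exact form**: if `H_i ⊆ G_i` and `G_0 ∩ G_1 ∩ G_2 ⊆ H_0` then
`T⁺ = E_3(G_0,H_1,G_2) + E_3(G_0,G_1,H_2) + δ_0·Cov(G_1,G_2) + μ(G_2)·μ(D_0 ∩ H_1) + μ(G_1)·μ(D_0 ∩ H_2) + 2μ(G_0 ∩ D_1 ∩ D_2) − μ(G_0)·μ(D_1 ∩ D_2)`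
(the last two masses written by inclusion–exclusion; ring identity after the one set rewrite `H_0H_1H_2 = G_0H_1H_2`).  The ONLY negative
term is `μ(G_0)·μ(D_1 ∩ D_2 ∖ G_0)`: mass removed from both other slots outside the costless slot's top event. [this work] -/
theorem twoLevelTop_eq_of_costless₀ (q : κ → unitInterval) (G H : Fin 3 → Set (Set κ)) (hH0 : H 0 ⊆ G 0)
    (hH1 : H 1 ⊆ G 1) (hH2 : H 2 ⊆ G 2) (hc0 : G 0 ∩ G 1 ∩ G 2 ⊆ H 0) :
    twoLevelForm (fun A => (prodBernoulli q).real A) G H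
        - ∏ i, ((prodBernoulli q).real (G i) - (prodBernoulli q).real (H i)) =
      sahiE3 (prodBernoulli q) (G 0) (H 1) (G 2) + sahiE3 (prodBernoulli q) (G 0) (G 1) (H 2)
      + ((prodBernoulli q).real (G 0) - (prodBernoulli q).real (H 0))
          * ((prodBernoulli q).real (G 1 ∩ G 2) - (prodBernoulli q).real (G 1) * (prodBernoulli q).real (G 2))
      + (prodBernoulli q).real (G 2) * ((prodBernoulli q).real (G 0 ∩ H 1) - (prodBernoulli q).real (H 0 ∩ H 1))
      + (prodBernoulli q).real (G 1) * ((prodBernoulli q).real (G 0 ∩ H 2) - (prodBernoulli q).real (H 0 ∩ H 2))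
      + 2 * ((prodBernoulli q).real (G 0 ∩ G 1 ∩ G 2) - (prodBernoulli q).real (G 0 ∩ H 1 ∩ G 2)
              - (prodBernoulli q).real (G 0 ∩ G 1 ∩ H 2) + (prodBernoulli q).real (G 0 ∩ H 1 ∩ H 2))
      - (prodBernoulli q).real (G 0) * ((prodBernoulli q).real (G 1 ∩ G 2) - (prodBernoulli q).real (H 1 ∩ G 2)
              - (prodBernoulli q).real (G 1 ∩ H 2) + (prodBernoulli q).real (H 1 ∩ H 2)) := by
  have e3 : H 0 ∩ H 1 ∩ H 2 = G 0 ∩ H 1 ∩ H 2 := by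
    ext ω; simp only [Set.mem_inter_iff]
    exact ⟨fun ⟨⟨a, b⟩, c⟩ => ⟨⟨hH0 a, b⟩, c⟩,
      fun ⟨⟨a, b⟩, c⟩ => ⟨⟨hc0 ⟨⟨a, hH1 b⟩, hH2 c⟩, b⟩, c⟩⟩
  simp only [twoLevelForm, Fin.prod_univ_three, sahiE3_def]
  rw [e3]
  ring

/-- **Slot `0` costless and `D_1 ∩ D_2 ⊆ G_0` ⟹ `T⁺ ≥ E_3(G_0,H_1,G_2) + E_3(G_0,G_1,H_2)`** (the deficit term vanishes; the rest is
Harris for `(G_1,G_2)`, monotonicity and a pointwise inclusion–exclusion).  Generalises `sahiE3_add_sahiE3_le_twoLevelTop_of_idle₀_inside`. [this work] -/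
theorem sahiE3_add_sahiE3_le_twoLevelTop_of_costless₀_inside [Fintype κ] (q : κ → unitInterval) (G H : Fin 3 → Set (Set κ))
    (hG : ∀ i, IsUpperSet (G i)) (hH0 : H 0 ⊆ G 0) (hH1 : H 1 ⊆ G 1) (hH2 : H 2 ⊆ G 2) (hc0 : G 0 ∩ G 1 ∩ G 2 ⊆ H 0)
    (hin : (G 1 \ H 1) ∩ (G 2 \ H 2) ⊆ G 0) :
    sahiE3 (prodBernoulli q) (G 0) (H 1) (G 2) + sahiE3 (prodBernoulli q) (G 0) (G 1) (H 2) ≤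
      twoLevelForm (fun A => (prodBernoulli q).real A) G H
        - ∏ i, ((prodBernoulli q).real (G i) - (prodBernoulli q).real (H i)) := by
  rw [twoLevelTop_eq_of_costless₀ q G H hH0 hH1 hH2 hc0]
  have hc1 : (prodBernoulli q).real (G 0) ≤ 1 := measureReal_le_one
  have hδ0 : 0 ≤ (prodBernoulli q).real (G 0) - (prodBernoulli q).real (H 0) := sub_nonneg.2 (measureReal_mono hH0)
  have hcv : 0 ≤ (prodBernoulli q).real (G 1 ∩ G 2) - (prodBernoulli q).real (G 1) * (prodBernoulli q).real (G 2) :=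
    sub_nonneg.2 (prodBernoulli_harris q (hG 1) (hG 2) MeasurableSet.of_discrete MeasurableSet.of_discrete)
  have hA : 0 ≤ (prodBernoulli q).real (G 0 ∩ H 1) - (prodBernoulli q).real (H 0 ∩ H 1) :=
    sub_nonneg.2 (measureReal_mono (Set.inter_subset_inter_left _ hH0))
  have hB : 0 ≤ (prodBernoulli q).real (G 0 ∩ H 2) - (prodBernoulli q).real (H 0 ∩ H 2) :=
    sub_nonneg.2 (measureReal_mono (Set.inter_subset_inter_left _ hH0))
  have hg1 : 0 ≤ (prodBernoulli q).real (G 1) := measureReal_nonneg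
  have hg2 : 0 ≤ (prodBernoulli q).real (G 2) := measureReal_nonneg
  have key : 0 ≤ 2 * ((prodBernoulli q).real (G 0 ∩ G 1 ∩ G 2) - (prodBernoulli q).real (G 0 ∩ H 1 ∩ G 2)
              - (prodBernoulli q).real (G 0 ∩ G 1 ∩ H 2) + (prodBernoulli q).real (G 0 ∩ H 1 ∩ H 2))
      - (prodBernoulli q).real (G 0) * ((prodBernoulli q).real (G 1 ∩ G 2) - (prodBernoulli q).real (H 1 ∩ G 2)
              - (prodBernoulli q).real (G 1 ∩ H 2) + (prodBernoulli q).real (H 1 ∩ H 2)) := by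
    set c := (prodBernoulli q).real (G 0) with hc
    simp only [← ex_bernoulliWeight_ind]
    have hsum : 2 * (ex (bernoulliWeight q) (ind (G 0 ∩ G 1 ∩ G 2)) - ex (bernoulliWeight q) (ind (G 0 ∩ H 1 ∩ G 2))
              - ex (bernoulliWeight q) (ind (G 0 ∩ G 1 ∩ H 2)) + ex (bernoulliWeight q) (ind (G 0 ∩ H 1 ∩ H 2)))
        - c * (ex (bernoulliWeight q) (ind (G 1 ∩ G 2)) - ex (bernoulliWeight q) (ind (H 1 ∩ G 2))
              - ex (bernoulliWeight q) (ind (G 1 ∩ H 2)) + ex (bernoulliWeight q) (ind (H 1 ∩ H 2))) =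
        ex (bernoulliWeight q) (fun ω => 2 * (ind (G 0) ω * ((ind (G 1) ω - ind (H 1) ω) * (ind (G 2) ω - ind (H 2) ω)))
          - c * ((ind (G 1) ω - ind (H 1) ω) * (ind (G 2) ω - ind (H 2) ω))) := by
      simp only [ex, ← Finset.sum_sub_distrib, ← Finset.sum_add_distrib, Finset.mul_sum, ind_inter_mul]
      exact Finset.sum_congr rfl fun ω _ => by ring
    rw [hsum]
    exact ex_nonneg (isFKGMeasure_bernoulliWeight q).nonneg fun ω =>
      inside_pointwise (G 0) (G 1) (H 1) (G 2) (H 2) hH1 hH2 hin hc1 ω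
  nlinarith [mul_nonneg hδ0 hcv, mul_nonneg hg2 hA, mul_nonneg hg1 hB]

/-- **`SahiTwoLevelPlus` with one costless slot whose top event contains `D_1 ∩ D_2`, from `C_3`** for `(G_0,H_1,G_2)` and
`(G_0,G_1,H_2)`. [this work] -/
theorem twoLevelTop_nonneg_of_costless₀_inside [Fintype κ] (q : κ → unitInterval) (G H : Fin 3 → Set (Set κ))
    (hG : ∀ i, IsUpperSet (G i)) (hH0 : H 0 ⊆ G 0) (hH1 : H 1 ⊆ G 1) (hH2 : H 2 ⊆ G 2) (hc0 : G 0 ∩ G 1 ∩ G 2 ⊆ H 0)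
    (hin : (G 1 \ H 1) ∩ (G 2 \ H 2) ⊆ G 0)
    (hE₃a : 0 ≤ sahiE3 (prodBernoulli q) (G 0) (H 1) (G 2)) (hE₃b : 0 ≤ sahiE3 (prodBernoulli q) (G 0) (G 1) (H 2)) :
    0 ≤ twoLevelForm (fun A => (prodBernoulli q).real A) G H
        - ∏ i, ((prodBernoulli q).real (G i) - (prodBernoulli q).real (H i)) :=
  le_trans (add_nonneg hE₃a hE₃b) (sahiE3_add_sahiE3_le_twoLevelTop_of_costless₀_inside q G H hG hH0 hH1 hH2 hc0 hin)

end Summit.CriticalPhenomena.PercolationContinuityZ3.Theorems.SahiTwoLevelIdle
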